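import Mathlib
import HarnessLib

/-!
# PerronMerge — decomp-res node «PerronLadder» (lens-1 g17 KaplanskyLadder → g18 PerronLadder), tree file 4/11 of the node

Content VERBATIM from the decomp-res lens-1 g18 file `HOME/decomp-res-lens-1/g18/PerronLadder.lean` (sha256
8bb02ceefe11b749, 3725 l; it SUPERSEDES
g17 `KaplanskyLadder.lean` fb35e2e5 ⊇ g16 `ToricLadder.lean` 67376591 as landing source; PARTS I–III = the
landed `Theorems/ToricLadderCells`,
`ToricLadderKernels`, `ToricLadderLinks`, `ToricLadderDense`, `ToricLadder` — not repeated).  HOME =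
run/shared/lean/pub/decomp-res.  Critic:
CRITIC-LEDGER rows 131 (g17, 2026-08-30T18:47:14Z) and 138 (g18 CLEARED, landing order 2026-08-30T20:05:14Z); the
lens's WRITER.md (endorsed).
Landed by decomp-res writer g7 as SUPPORT of the Valuative route item 0641 `LuAlphaPTorsor` (helper files; no
Valuative route edit is made by the
decomp-res cell: the support ports Σ₁ `MonoidalStep` / Π₁ `KK05NCVAscent`, the retirement of g16's all-rank
`ToricAscent 3` in favour of the theorem
`toricAscentRk1_three`, and the UNCHANGED located residual `NonKHToricArchLU 3 3 4` / port-free `NonKHArchLU 3 4`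
stay documented tree definitions
for the Valuative tenure / operator to book).

PART V-A (g18 NEW) §17 KERNEL · LEMMA M: Perron–Zariski merging of `≤ 3` rank-one values by legal subtractive
moves (the value-group side
of a sequence of monoidal transforms with two-parameter centres; pure real/integer combinatorics, Mathlib only).
PROVED, 0 sorry.  The lens's node
description and the writer note are reproduced in `PerronMonomialization`.

(Sources: CossartPiltant2019; CossartJannsenSaito2020; KnafKuhlmann2005 arXiv:math/0304159 §4 Thm 4.1, Lemmas
4.2–4.4; KnafKuhlmann2009 arXiv:math/0702856 Prop 3.11, Thm 1.5; Kaplansky1942 Lemma 5, Thm 3; Kuhlmann2010 Thm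
2.14; Zariski1940 §B; Cutkosky arXiv:1404.7459 §2.1; ZariskiSamuelII.)
-/

noncomputable section

namespace Summit.ResolutionOfSingularities.ResolutionOfSingularities.Theorems.PerronLadder

/-! # PART V — THE PERRON LADDER (gen 18, NEW): `ToricAscentRk1 3` decided modulo CJS-2020 + Σ₁ + Π₁ -/

section PartV

open Finset
open CategoryTheory CategoryTheory.Limits AlgebraicGeometry TopologicalSpace
open Scheme.IdealSheafData
open scoped Classical

/-! ## 17. PART V-A · KERNEL · LEMMA M: Perron–Zariski merging of `≤ 3` rank-one values by legal
subtractive moves (the value-group side of a sequence of monoidal transforms with two-parameter centres) -/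

variable {m : ℕ}

/-- `MergeReachable τ`: starting from the value vector `τ` (entries `≥ 0`; zero entries = units),
some finite sequence of LEGAL SUBTRACTIVE MOVES `τ i ↦ τ i - τ s` (`i ≠ s`, `0 < τ s ≤ τ i`; the
monoidal transform with centre `(t_i, t_s)` followed through the chart `t_i = t_i' t_s`, a TIE
`τ i = τ s` producing a unit `t_i' = t_i / t_s`) reaches a vector whose NON-ZERO entries are
`ℤ`-independent. -/
inductive MergeReachable : (Fin m → ℝ) → Prop
  | done (τ : Fin m → ℝ)
      (h : ∀ n : Fin m → ℤ, (∀ i, τ i = 0 → n i = 0) → (∑ i, (n i : ℝ) * τ i) = 0 → n = 0) :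
      MergeReachable τ
  | step (τ : Fin m → ℝ) (i s : Fin m) (his : i ≠ s) (hs : 0 < τ s) (hle : τ s ≤ τ i)
      (h : MergeReachable (Function.update τ i (τ i - τ s))) : MergeReachable τ

/-- An integer relation among the non-zero entries of `τ`. -/
def IsRel (τ : Fin m → ℝ) (n : Fin m → ℤ) : Prop :=
  (∀ i, τ i = 0 → n i = 0) ∧ (∑ i, (n i : ℝ) * τ i) = 0 ∧ n ≠ 0

/-- The weight `Σ |n i|` of a relation (the descending potential). -/
def wt (n : Fin m → ℤ) : ℤ := ∑ i, |n i|

/-- The number of non-zero entries. -/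
def nz (τ : Fin m → ℝ) : ℕ := (univ.filter fun i => τ i ≠ 0).card

/-- `wt_nonneg`: Auxiliary step of this node's calculus, VERBATIM from the lens file (see the module docstring); the
statement is its type. [folklore] -/
theorem wt_nonneg (n : Fin m → ℤ) : 0 ≤ wt n := Finset.sum_nonneg fun _ _ => abs_nonneg _

/-- `wt_neg`: Auxiliary step of this node's calculus, VERBATIM from the lens file (see the module docstring); the
statement is its type. [folklore] -/
theorem wt_neg (n : Fin m → ℤ) : wt (-n) = wt n := by
  simp [wt, abs_neg]

/-- `isRel_neg`: Auxiliary step of this node's calculus, VERBATIM from the lens file (see the module docstring); the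
statement is its type. [folklore] -/
theorem isRel_neg {τ : Fin m → ℝ} {n : Fin m → ℤ} (h : IsRel τ n) : IsRel τ (-n) := by
  obtain ⟨h1, h2, h3⟩ := h
  refine ⟨fun i hi => by simp [h1 i hi], ?_, neg_ne_zero.mpr h3⟩
  have : (∑ i, ((-n) i : ℝ) * τ i) = -∑ i, (n i : ℝ) * τ i := by
    rw [← Finset.sum_neg_distrib]
    refine Finset.sum_congr rfl fun i _ => ?_
    simp [neg_mul]
  rw [this, h2, neg_zero]

/-- `sum_eq_three`: Auxiliary step of this node's calculus, VERBATIM from the lens file (see the module docstring);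
the statement is its type. [folklore] -/
theorem sum_eq_three {β : Type*} [AddCommMonoid β] (f : Fin m → β) {a b : Fin m} (hab : a ≠ b) :
    ∑ l, f l = f a + f b + ∑ l ∈ (univ.erase a).erase b, f l := by
  rw [← Finset.add_sum_erase _ _ (mem_univ a),
    ← Finset.add_sum_erase _ _ (Finset.mem_erase.mpr ⟨hab.symm, mem_univ b⟩), add_assoc]

/-- `sum_eq_four`: Auxiliary step of this node's calculus, VERBATIM from the lens file (see the module docstring);
the statement is its type. [folklore] -/
theorem sum_eq_four {β : Type*} [AddCommMonoid β] (f : Fin m → β) {a b c : Fin m} (hab : a ≠ b)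
    (hac : a ≠ c) (hbc : b ≠ c) :
    ∑ l, f l = f a + f b + f c + ∑ l ∈ ((univ.erase a).erase b).erase c, f l := by
  rw [sum_eq_three f hab,
    ← Finset.add_sum_erase _ _
      (Finset.mem_erase.mpr ⟨hbc.symm, Finset.mem_erase.mpr ⟨hac.symm, mem_univ c⟩⟩)]
  abel

/-- `nz_update_lt`: Auxiliary step of this node's calculus, VERBATIM from the lens file (see the module docstring);
the statement is its type. [folklore] -/
theorem nz_update_lt {τ : Fin m → ℝ} {i s : Fin m} (heq : τ i = τ s) (hs : 0 < τ s) :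
    nz (Function.update τ i (τ i - τ s)) < nz τ := by
  unfold nz
  apply Finset.card_lt_card
  rw [Finset.ssubset_iff_of_subset]
  · refine ⟨i, ?_, ?_⟩
    · simp [heq, hs.ne']
    · simp [heq]
  · intro j hj
    simp only [mem_filter, mem_univ, true_and] at hj ⊢
    by_cases hji : j = i
    · subst hji; simp [heq] at hj
    · rwa [Function.update_of_ne hji] at hj

/-- `nz_update_le`: Auxiliary step of this node's calculus, VERBATIM from the lens file (see the module docstring);
the statement is its type. [folklore] -/
theorem nz_update_le {τ : Fin m → ℝ} {i s : Fin m} (hi : τ i ≠ 0) :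
    nz (Function.update τ i (τ i - τ s)) ≤ nz τ := by
  unfold nz
  apply Finset.card_le_card
  intro j hj
  simp only [mem_filter, mem_univ, true_and] at hj ⊢
  by_cases hji : j = i
  · subst hji; exact hi
  · rwa [Function.update_of_ne hji] at hj

/-- `isRel_update`: Auxiliary step of this node's calculus, VERBATIM from the lens file (see the module docstring);
the statement is its type. [folklore] -/
theorem isRel_update {τ : Fin m → ℝ} {n : Fin m → ℤ} (h : IsRel τ n) {i s : Fin m} (his : i ≠ s)
    (hs : 0 < τ s) (hlt : τ s < τ i) (hni : n i ≠ 0) :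
    IsRel (Function.update τ i (τ i - τ s)) (Function.update n s (n s + n i)) := by
  obtain ⟨h1, h2, h3⟩ := h
  refine ⟨?_, ?_, ?_⟩
  · intro j hj
    by_cases hji : j = i
    · subst hji
      simp only [Function.update_self] at hj
      linarith
    · rw [Function.update_of_ne hji] at hj
      by_cases hjs : j = s
      · subst hjs; linarith
      · rw [Function.update_of_ne hjs]; exact h1 j hj
  · rw [sum_eq_three _ his] at h2 ⊢
    have hrest : ∑ l ∈ (univ.erase i).erase s,
        ((Function.update n s (n s + n i) l : ℤ) : ℝ) * Function.update τ i (τ i - τ s) l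
        = ∑ l ∈ (univ.erase i).erase s, (n l : ℝ) * τ l := by
      refine Finset.sum_congr rfl fun l hl => ?_
      have hls : l ≠ s := (Finset.mem_erase.mp hl).1
      have hli : l ≠ i := (Finset.mem_erase.mp (Finset.mem_erase.mp hl).2).1
      rw [Function.update_of_ne hls, Function.update_of_ne hli]
    rw [hrest, Function.update_self, Function.update_of_ne his, Function.update_of_ne his.symm,
      Function.update_self]
    push_cast
    linarith
  · intro h0
    have := congr_fun h0 i
    rw [Function.update_of_ne his] at this
    exact hni this

/-- `wt_update`: Auxiliary step of this node's calculus, VERBATIM from the lens file (see the module docstring); the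
statement is its type. [folklore] -/
theorem wt_update (n : Fin m → ℤ) (s : Fin m) (v : ℤ) :
    wt (Function.update n s v) = wt n - |n s| + |v| := by
  unfold wt
  rw [← Finset.add_sum_erase _ _ (mem_univ s),
    ← Finset.add_sum_erase univ (fun i => |n i|) (mem_univ s)]
  simp only [Function.update_self]
  have : ∑ x ∈ univ.erase s, |Function.update n s v x| = ∑ x ∈ univ.erase s, |n x| :=
    Finset.sum_congr rfl fun x hx => by rw [Function.update_of_ne (Finset.mem_erase.mp hx).1]
  rw [this]; ring

/-- `false_of_four`: Auxiliary step of this node's calculus, VERBATIM from the lens file (see the module docstring);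
the statement is its type. [folklore] -/
theorem false_of_four (hm : m ≤ 3) {a b c d : Fin m} (hab : a ≠ b) (hac : a ≠ c) (had : a ≠ d)
    (hbc : b ≠ c) (hbd : b ≠ d) (hcd : c ≠ d) : False := by
  have h := Finset.card_le_univ ({a, b, c, d} : Finset (Fin m))
  rw [Finset.card_insert_of_notMem, Finset.card_insert_of_notMem, Finset.card_pair hcd] at h
  · simp only [Fintype.card_fin] at h; omega
  · simp [hbc, hbd]
  · simp [hab, hac, had]

/-- The case analysis: no ties, `s` of minimal value in the support, `n s < 0`. [folklore] -/
theorem exists_step_aux (hm : m ≤ 3) {τ : Fin m → ℝ} (h0 : ∀ i, 0 ≤ τ i) {n : Fin m → ℤ}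
    (hn : IsRel τ n) (htie : ∀ i s, i ≠ s → 0 < τ s → τ i ≠ τ s) {s : Fin m} (hns : n s < 0)
    (hmin : ∀ j, n j ≠ 0 → τ s ≤ τ j) :
    ∃ i s', i ≠ s' ∧ 0 < τ s' ∧ τ s' ≤ τ i ∧
      ∃ n', IsRel (Function.update τ i (τ i - τ s')) n' ∧ wt n' < wt n := by
  have hpos : ∀ j, n j ≠ 0 → 0 < τ j := fun j hj =>
    lt_of_le_of_ne (h0 j) (fun h => hj (hn.1 j h.symm))
  have hτs : 0 < τ s := hpos s hns.ne
  have hnsR : (n s : ℝ) < 0 := by exact_mod_cast hns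
  -- a positive coefficient exists
  have hex : ∃ i, 0 < n i := by
    by_contra hno
    push Not at hno
    have hlt : (∑ l, (n l : ℝ) * τ l) < 0 := by
      rw [← Finset.add_sum_erase _ _ (mem_univ s)]
      have h1 : (n s : ℝ) * τ s < 0 := mul_neg_of_neg_of_pos hnsR hτs
      have h2 : ∑ l ∈ univ.erase s, (n l : ℝ) * τ l ≤ 0 :=
        Finset.sum_nonpos fun l _ => by
          have hl : (n l : ℝ) ≤ 0 := by exact_mod_cast hno l
          have hl' := h0 l
          nlinarith
      linarith
    linarith [hn.2.1]
  obtain ⟨i, hni⟩ := hex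
  have hniR : (0 : ℝ) < n i := by exact_mod_cast hni
  have his : i ≠ s := fun h => by subst h; omega
  have hτi : τ s < τ i := lt_of_le_of_ne (hmin i hni.ne') (fun h => htie i s his hτs h.symm)
  by_cases hA : n i < -2 * n s
  · refine ⟨i, s, his, hτs, hτi.le, Function.update n s (n s + n i),
      isRel_update hn his hτs hτi hni.ne', ?_⟩
    rw [wt_update]
    have : |n s + n i| < |n s| := by
      rw [abs_of_neg hns, abs_lt]; constructor <;> linarith
    linarith
  · push Not at hA
    have hAR : (-2 * (n s : ℝ)) ≤ n i := by exact_mod_cast hA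
    by_cases hQ : ∃ j, j ≠ s ∧ j ≠ i ∧ n j ≠ 0
    · obtain ⟨j, hjs, hji, hnj⟩ := hQ
      have hτj : τ s < τ j := lt_of_le_of_ne (hmin j hnj) (fun h => htie j s hjs hτs h.symm)
      have hτij : τ i ≠ τ j := fun h => htie i j hji.symm (hpos j hnj) h
      have hzero : ∀ l, l ≠ s → l ≠ i → l ≠ j → n l = 0 := fun l h1 h2 h3 => by
        by_contra h4
        exact false_of_four hm his.symm hjs.symm (Ne.symm h1) hji.symm (Ne.symm h2) (Ne.symm h3)
      have hrel : (n s : ℝ) * τ s + (n i : ℝ) * τ i + (n j : ℝ) * τ j = 0 := by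
        have h := hn.2.1
        rw [sum_eq_four _ his.symm hjs.symm hji.symm] at h
        have hrest : ∑ l ∈ ((univ.erase s).erase i).erase j, (n l : ℝ) * τ l = 0 :=
          Finset.sum_eq_zero fun l hl => by
            simp only [Finset.mem_erase, mem_univ, and_true] at hl
            rw [hzero l hl.2.2 hl.2.1 hl.1, Int.cast_zero, zero_mul]
        linarith
      rcases lt_or_gt_of_ne hnj with hnjneg | hnjpos
      · have hnjR : (n j : ℝ) < 0 := by exact_mod_cast hnjneg
        rcases lt_or_gt_of_ne hτij with hlt | hgt
        · -- `τ i < τ j`: move `(j, i)`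
          refine ⟨j, i, hji, hpos i hni.ne', hlt.le, Function.update n i (n i + n j),
            isRel_update hn hji (hpos i hni.ne') hlt hnj, ?_⟩
          rw [wt_update]
          have key : -n j < n i := by
            by_contra hc
            push Not at hc
            have hcR : (n i : ℝ) ≤ -(n j : ℝ) := by exact_mod_cast hc
            have h1 : (n i : ℝ) * τ i < (n i : ℝ) * τ j := mul_lt_mul_of_pos_left hlt hniR
            have h2 : (n i : ℝ) * τ j ≤ (-(n j : ℝ)) * τ j :=
              mul_le_mul_of_nonneg_right hcR (h0 j)
            have h3 : (0 : ℝ) < -(n s : ℝ) * τ s := by nlinarith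
            nlinarith
          have : |n i + n j| < |n i| := by
            rw [abs_of_pos hni, abs_lt]; constructor <;> linarith
          linarith
        · -- `τ j < τ i`: move `(i, j)`
          refine ⟨i, j, hji.symm, hpos j hnj, hgt.le, Function.update n j (n j + n i),
            isRel_update hn hji.symm (hpos j hnj) hgt hni.ne', ?_⟩
          rw [wt_update]
          have key : n i < -2 * n j := by
            by_contra hc
            push Not at hc
            have hc2 : (-(n j : ℝ)) - n s ≤ n i := by
              have : -(n j) - n s ≤ n i := by linarith
              exact_mod_cast this
            have h1 : ((-(n j : ℝ)) - n s) * τ i ≤ (n i : ℝ) * τ i :=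
              mul_le_mul_of_nonneg_right hc2 (h0 i)
            have h2 : (-(n j : ℝ)) * τ j < (-(n j : ℝ)) * τ i :=
              mul_lt_mul_of_pos_left hgt (by linarith)
            have h3 : (-(n s : ℝ)) * τ s < (-(n s : ℝ)) * τ i :=
              mul_lt_mul_of_pos_left hτi (by linarith)
            nlinarith
          have : |n j + n i| < |n j| := by
            rw [abs_of_neg hnjneg, abs_lt]; constructor <;> linarith
          linarith
      · by_cases hA' : n j < -2 * n s
        · refine ⟨j, s, hjs, hτs, hτj.le, Function.update n s (n s + n j),
            isRel_update hn hjs hτs hτj hnj, ?_⟩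
          rw [wt_update]
          have : |n s + n j| < |n s| := by
            rw [abs_of_neg hns, abs_lt]; constructor <;> linarith
          linarith
        · push Not at hA'
          exfalso
          have hAR' : (-2 * (n s : ℝ)) ≤ n j := by exact_mod_cast hA'
          have h1 : (-2 * (n s : ℝ)) * τ i ≤ (n i : ℝ) * τ i :=
            mul_le_mul_of_nonneg_right hAR (h0 i)
          have h2 : (-2 * (n s : ℝ)) * τ j ≤ (n j : ℝ) * τ j :=
            mul_le_mul_of_nonneg_right hAR' (h0 j)
          nlinarith
    · push Not at hQ
      exfalso
      have hrel : (n s : ℝ) * τ s + (n i : ℝ) * τ i = 0 := by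
        have h := hn.2.1
        rw [sum_eq_three _ his.symm] at h
        have hrest : ∑ l ∈ (univ.erase s).erase i, (n l : ℝ) * τ l = 0 :=
          Finset.sum_eq_zero fun l hl => by
            simp only [Finset.mem_erase, mem_univ, and_true] at hl
            rw [hQ l hl.2 hl.1, Int.cast_zero, zero_mul]
        linarith
      have h1 : (-2 * (n s : ℝ)) * τ i ≤ (n i : ℝ) * τ i :=
        mul_le_mul_of_nonneg_right hAR (h0 i)
      nlinarith

/-- **One good move always exists** (at most three parameters): either a tie is merged (the
number of non-units drops) or the weight of some relation drops. [folklore] -/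
theorem exists_step (hm : m ≤ 3) {τ : Fin m → ℝ} (h0 : ∀ i, 0 ≤ τ i) {n : Fin m → ℤ}
    (hn : IsRel τ n) :
    ∃ i s, i ≠ s ∧ 0 < τ s ∧ τ s ≤ τ i ∧
      (nz (Function.update τ i (τ i - τ s)) < nz τ ∨
        ∃ n', IsRel (Function.update τ i (τ i - τ s)) n' ∧ wt n' < wt n) := by
  by_cases htie : ∃ i s, i ≠ s ∧ 0 < τ s ∧ τ i = τ s
  · obtain ⟨i, s, his, hs, heq⟩ := htie
    exact ⟨i, s, his, hs, heq.ge, Or.inl (nz_update_lt heq hs)⟩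
  · push Not at htie
    have hP : (univ.filter fun j => n j ≠ 0).Nonempty := by
      by_contra h
      rw [Finset.not_nonempty_iff_eq_empty] at h
      have hall : ∀ j, n j = 0 := fun j => by
        by_contra hj
        have hmem : j ∈ univ.filter fun j => n j ≠ 0 := by simp [hj]
        rw [h] at hmem
        simp at hmem
      exact hn.2.2 (funext hall)
    obtain ⟨s, hsP, hsmin⟩ := Finset.exists_min_image _ τ hP
    have hns : n s ≠ 0 := by simpa using hsP
    have hmin : ∀ j, n j ≠ 0 → τ s ≤ τ j := fun j hj => hsmin j (by simpa using hj)
    rcases lt_or_gt_of_ne hns with hneg | hposn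
    · obtain ⟨i, s', h1, h2, h3, n', h4, h5⟩ := exists_step_aux hm h0 hn htie hneg hmin
      exact ⟨i, s', h1, h2, h3, Or.inr ⟨n', h4, h5⟩⟩
    · have hneg : (-n) s < 0 := by simpa using hposn
      have hmin' : ∀ j, (-n) j ≠ 0 → τ s ≤ τ j := fun j hj => hmin j (by simpa using hj)
      obtain ⟨i, s', h1, h2, h3, n', h4, h5⟩ :=
        exists_step_aux hm h0 (isRel_neg hn) htie hneg hmin'
      exact ⟨i, s', h1, h2, h3, Or.inr ⟨n', h4, by rwa [wt_neg] at h5⟩⟩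

/-- **THE PERRON–EUCLID MERGING LEMMA (≤ 3 parameters).**  From ANY vector of `m ≤ 3`
non-negative real values, finitely many legal subtractive moves reach a vector whose non-zero
entries are `ℤ`-independent. [folklore] -/
theorem mergeReachable_of_le_three (hm : m ≤ 3) (τ : Fin m → ℝ) (h0 : ∀ i, 0 ≤ τ i) :
    MergeReachable τ := by
  suffices H : ∀ c : ℕ, ∀ τ : Fin m → ℝ, (∀ i, 0 ≤ τ i) → nz τ ≤ c → MergeReachable τ from
    H _ τ h0 le_rfl
  intro c
  induction c using Nat.strong_induction_on with
  | _ c IHc =>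
    intro τ h0 hc
    by_cases hind : ∀ n : Fin m → ℤ, (∀ i, τ i = 0 → n i = 0) → (∑ i, (n i : ℝ) * τ i) = 0 → n = 0
    · exact MergeReachable.done τ hind
    · push Not at hind
      obtain ⟨n, h1, h2, h3⟩ := hind
      suffices H2 : ∀ w : ℕ, ∀ (τ : Fin m → ℝ) (n : Fin m → ℤ), (∀ i, 0 ≤ τ i) → nz τ ≤ c →
          IsRel τ n → wt n ≤ w → MergeReachable τ from
        H2 (wt n).toNat τ n h0 hc ⟨h1, h2, h3⟩ (by
          have := Int.toNat_of_nonneg (wt_nonneg n)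
          omega)
      intro w
      induction w using Nat.strong_induction_on with
      | _ w IHw =>
        intro τ n h0 hc hn hw
        obtain ⟨i, s, his, hs, hle, halt⟩ := exists_step hm h0 hn
        refine MergeReachable.step τ i s his hs hle ?_
        have h0' : ∀ j, 0 ≤ Function.update τ i (τ i - τ s) j := by
          intro j
          by_cases hji : j = i
          · subst hji; simp only [Function.update_self]; linarith
          · rw [Function.update_of_ne hji]; exact h0 j
        rcases halt with hlt | ⟨n', hn', hwt⟩
        · exact IHc _ (by omega) _ h0' le_rfl
        · have hle' : nz (Function.update τ i (τ i - τ s)) ≤ c :=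
            (nz_update_le (by linarith : τ i ≠ 0)).trans hc
          exact IHw (wt n').toNat (by
            have := Int.toNat_of_nonneg (wt_nonneg n')
            omega) _ n' h0' hle' hn' (by
            have := Int.toNat_of_nonneg (wt_nonneg n')
            omega)

end PartV

end Summit.ResolutionOfSingularities.ResolutionOfSingularities.Theorems.PerronLadder
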